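import Mathlib.Topology.Algebra.ContinuousMonoidHom
import Mathlib.Topology.Algebra.Group.Basic
import Mathlib.NumberTheory.Padics.RingHoms
import Mathlib.NumberTheory.Padics.ProperSpace
import HarnessLib

/-!
# Closed procyclic subgroups as images: `range α = cl⟨α e⟩` and transport along topological
# automorphisms ([SemiAnbd] Def. 2.1 / Thm 3.7 (iii) bookkeeping for the sliding-ray countermodel)

Mochizuki, *Semi-graphs of anabelioids*, Publ. RIMS **42** (2006), Def. 2.1 p. 22–23 (a semi-graph of
anabelioids in the local presentation "semi-graph of profinite groups": the edge groups ENTER the vertex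
groups through continuous injections, and the "branch subgroups" are their images)
[cite: MochizukiSemiAnbd2006, Def 2.1 p.22].  abc-iut cell, layer L3, FRONTIER programme
SUBDAG-REFUTE-F1732 (honest framing: «towards a kernel erratum for the ∀-countable reading of [SemiAnbd]
Thm 3.7 (iii) ([IUTchI] Rmk 2.5.3); desk countermodel abc-iut-L3-d1 g3 memo 8b26b5199c29f55f; print
proves finite `𝔾` (kernel: p431007)»), brick **R2a-bis** (seat abc-iut-L3-t7 gen 5).

PROOF-ONLY, Mathlib-only bridging lemmas between the two currencies in which the branch subgroups of
`𝒢_θ` appear: brick R3 (`ThetaRayGraph.lean`, abc-iut-w6-d070) has them as `range α` and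
`(range α).map θ_{n_k}` for the gluing `α : E →* G` (`E = ℤ_p`) and the twists `θ_m : G ≃ₜ* G`; brick R2a
(`FreeProPTwoSlimMalnormal.lean`) and the tree's pro-`Σ` engine speak of closed procyclic subgroups
`cl⟨y⟩ := (Subgroup.zpowers y).topologicalClosure`.  The bridges:

* `MonoidHom.range_eq_topologicalClosure_zpowers_of_dense` — for a continuous hom `α : E →* G` out of a
  COMPACT group in which `⟨e⟩` is dense, into a Hausdorff topological group: `range α = cl⟨α e⟩`;
* `PadicInt.topologicalClosure_zpowers_ofAdd_one` — in `Multiplicative ℤ_[p]`, `cl⟨ofAdd 1⟩ = ⊤`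
  (density of `ℤ` in `ℤ_p`), whence `MonoidHom.range_eq_topologicalClosure_zpowers_padicInt`:
  `range α = cl⟨α (ofAdd 1)⟩` for every continuous `α : Multiplicative ℤ_[p] →* G`;
* `ContinuousMulEquiv.map_topologicalClosure_zpowers` — for `θ : G ≃ₜ* H`,
  `(cl⟨x⟩).map θ = cl⟨θ x⟩`.

Classical; nothing of [SemiAnbd] is asserted; nothing here bears on [IUTchIII] Cor. 3.12.
-/

open scoped Pointwise Topology

/-! ### Images of closed procyclic subgroups -/

namespace MonoidHom

variable {E G : Type*} [Group E] [TopologicalSpace E] [Group G] [TopologicalSpace G]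

/-- **`range α = cl⟨α e⟩`**: for a continuous homomorphism `α : E →* G` from a compact group `E` in which
the cyclic subgroup `⟨e⟩` is dense, into a Hausdorff topological group `G`, the image of `α` is the closed
procyclic subgroup topologically generated by `α e` (the image of the compact `E` is closed and contains
`⟨α e⟩` densely). [cite: MochizukiSemiAnbd2006, Def 2.1 p.22] -/
theorem range_eq_topologicalClosure_zpowers_of_dense [IsTopologicalGroup E] [IsTopologicalGroup G]
    [CompactSpace E] [T2Space G] (α : E →* G) (hα : Continuous α) (e : E)
    (he : (Subgroup.zpowers e).topologicalClosure = ⊤) :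
    α.range = (Subgroup.zpowers (α e)).topologicalClosure := by
  apply le_antisymm
  · -- `α(E) = α(cl⟨e⟩) ⊆ cl α(⟨e⟩) = cl⟨α e⟩` by continuity
    rintro _ ⟨x, rfl⟩
    have hx : x ∈ (Subgroup.zpowers e).topologicalClosure := by rw [he]; exact Subgroup.mem_top x
    have hsub : α '' closure ((Subgroup.zpowers e : Subgroup E) : Set E) ⊆
        closure (α '' ((Subgroup.zpowers e : Subgroup E) : Set E)) :=
      image_closure_subset_closure_image hα
    have h1 : α x ∈ closure (α '' ((Subgroup.zpowers e : Subgroup E) : Set E)) :=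
      hsub ⟨x, hx, rfl⟩
    rw [← Subgroup.coe_map, MonoidHom.map_zpowers] at h1
    exact h1
  · -- `cl⟨α e⟩ ⊆ α(E)` since `α(E)` is closed (compact) and contains `⟨α e⟩`
    have hclosed : IsClosed (α.range : Set G) := by
      rw [MonoidHom.coe_range]
      exact (isCompact_range hα).isClosed
    refine (Subgroup.topologicalClosure_minimal _ ?_ hclosed)
    exact (Subgroup.zpowers_le).mpr ⟨e, rfl⟩

end MonoidHom

/-! ### `ℤ_p` is topologically generated by `1` -/

namespace PadicInt

variable {p : ℕ} [Fact p.Prime]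

/-- In `Multiplicative ℤ_[p]` the cyclic subgroup generated by `ofAdd 1` is dense: its closure is
everything (`ℤ` is dense in `ℤ_p`, `PadicInt.denseRange_intCast`). [cite: MochizukiSemiAnbd2006, Def 2.1 p.22] -/
theorem topologicalClosure_zpowers_ofAdd_one :
    (Subgroup.zpowers (Multiplicative.ofAdd (1 : ℤ_[p]))).topologicalClosure = ⊤ := by
  rw [eq_top_iff]
  intro x _
  change x ∈ closure ((Subgroup.zpowers (Multiplicative.ofAdd (1 : ℤ_[p])) : Subgroup _) : Set _)
  have hx : Multiplicative.toAdd x ∈ closure (Set.range (Int.cast : ℤ → ℤ_[p])) := by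
    rw [(denseRange_intCast (p := p)).closure_range]; exact Set.mem_univ _
  have hsub : Set.range (Int.cast : ℤ → ℤ_[p]) ⊆
      Multiplicative.toAdd '' ((Subgroup.zpowers (Multiplicative.ofAdd (1 : ℤ_[p])) : Subgroup _) : Set _) := by
    rintro _ ⟨n, rfl⟩
    refine ⟨Multiplicative.ofAdd (n : ℤ_[p]), ?_, rfl⟩
    rw [SetLike.mem_coe, Subgroup.mem_zpowers_iff]
    exact ⟨n, by rw [← ofAdd_zsmul, zsmul_one]⟩
  have h2 : Multiplicative.toAdd x ∈ closure (Multiplicative.toAdd ''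
      ((Subgroup.zpowers (Multiplicative.ofAdd (1 : ℤ_[p])) : Subgroup _) : Set _)) :=
    closure_mono hsub hx
  have hhomeo : Multiplicative.toAdd '' closure
      ((Subgroup.zpowers (Multiplicative.ofAdd (1 : ℤ_[p])) : Subgroup _) : Set (Multiplicative ℤ_[p])) =
      closure (Multiplicative.toAdd ''
        ((Subgroup.zpowers (Multiplicative.ofAdd (1 : ℤ_[p])) : Subgroup _) : Set _)) :=
    (Homeomorph.refl ℤ_[p]).image_closure _
  rw [← hhomeo] at h2
  obtain ⟨y, hy, hyx⟩ := h2
  have : y = x := hyx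
  exact this ▸ hy

/-- **`range α = cl⟨α 1⟩` for continuous homomorphisms out of `ℤ_p`**: for every continuous
`α : Multiplicative ℤ_[p] →* G` into a Hausdorff topological group, the image is the closed procyclic
subgroup generated by `α (ofAdd 1)` — the bridge between "edge group enters as `range α`" (brick R3) and
"branch subgroup `= cl⟨a⟩`" (brick R2a / the tree's pro-`Σ` malnormality engine).
[cite: MochizukiSemiAnbd2006, Def 2.1 p.22] -/
theorem _root_.MonoidHom.range_eq_topologicalClosure_zpowers_padicInt {G : Type*} [Group G]
    [TopologicalSpace G] [IsTopologicalGroup G] [T2Space G] (α : Multiplicative ℤ_[p] →* G)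
    (hα : Continuous α) :
    α.range = (Subgroup.zpowers (α (Multiplicative.ofAdd 1))).topologicalClosure :=
  haveI : CompactSpace (Multiplicative ℤ_[p]) := inferInstanceAs (CompactSpace ℤ_[p])
  α.range_eq_topologicalClosure_zpowers_of_dense hα _ topologicalClosure_zpowers_ofAdd_one

end PadicInt

/-! ### Transport along topological automorphisms -/

namespace ContinuousMulEquiv

variable {G H : Type*} [Group G] [TopologicalSpace G] [Group H] [TopologicalSpace H]

/-- **`θ(cl⟨x⟩) = cl⟨θ x⟩`** for an isomorphism of topological groups `θ : G ≃ₜ* H` (a homeomorphism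
carries closures to closures and `θ ⟨x⟩ = ⟨θ x⟩`) — the bridge between brick R3's lower branch subgroup
`(range α).map θ_{n_k}` and `cl⟨θ_{n_k} a⟩ = cl⟨a·b^{p^{n_k}}⟩`. [cite: MochizukiSemiAnbd2006, Def 2.1 p.22] -/
theorem map_topologicalClosure_zpowers [IsTopologicalGroup G] [IsTopologicalGroup H] (θ : G ≃ₜ* H)
    (x : G) :
    ((Subgroup.zpowers x).topologicalClosure).map θ.toMonoidHom =
      (Subgroup.zpowers (θ x)).topologicalClosure := by
  apply SetLike.coe_injective
  have h1 : ((Subgroup.zpowers x).map θ.toMonoidHom : Subgroup H) = Subgroup.zpowers (θ x) :=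
    MonoidHom.map_zpowers _ _
  rw [Subgroup.coe_map, Subgroup.topologicalClosure_coe, Subgroup.topologicalClosure_coe, ← h1,
    Subgroup.coe_map]
  exact θ.toHomeomorph.image_closure _

/-- Pointwise form: `y ∈ cl⟨θ x⟩ ↔ θ.symm y ∈ cl⟨x⟩`. [cite: MochizukiSemiAnbd2006, Def 2.1 p.22] -/
theorem mem_topologicalClosure_zpowers_apply_iff [IsTopologicalGroup G] [IsTopologicalGroup H]
    (θ : G ≃ₜ* H) (x : G) (y : H) :
    y ∈ (Subgroup.zpowers (θ x)).topologicalClosure ↔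
      θ.symm y ∈ (Subgroup.zpowers x).topologicalClosure := by
  rw [← map_topologicalClosure_zpowers θ x, Subgroup.mem_map]
  constructor
  · rintro ⟨z, hz, hzy⟩
    have : θ.symm y = z := by rw [← hzy]; exact θ.symm_apply_apply z
    rwa [this]
  · intro h
    exact ⟨θ.symm y, h, θ.apply_symm_apply y⟩

end ContinuousMulEquiv
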